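import Summits.BirchSwinnertonDyer.BirchSwinnertonDyer.Theorems.CyclotomicUntwistSigmaLineFamilyTransport
import Summits.BirchSwinnertonDyer.BirchSwinnertonDyer.Theorems.CyclotomicUntwistSigmaLineFamilyDivision
import Summits.BirchSwinnertonDyer.BirchSwinnertonDyer.Theorems.CountingDoorF2AtThreeSchneiderOnDoorSubfamilyTransportSigma
import HarnessLib

/-!
# The σ-line family under `(u, r, s, t)` — EVALUATION AT POINTS of Bernardi's closed disc
# `‖z‖ ≤ p⁻¹`: `σ^{vc•V}_{c'}(z(P')) = u·σ^V_{u²c'−r}(z(P))`, `log^{vc•V}(z(P')) = u·log^V(z(P))`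
# (route `CyclotomicUntwist`, crux K1 `PSRankOneLowerHalfAtThree`; MODEL COVARIANCE, part 2)

Cell `pub/bsd-wall` (D-0145 line `route-BirchSwinnertonDyer-CyclotomicUntwist`), width seat
`bsd-line-cycu-p5` (gen 8). THEOREMS ONLY (no definition, no named fact, no `sorry`); helper
`--supports` K1 = stmt-BirchSwinnertonDyer-21580 (serves K2 = 21581 equally). BSD is not proved by this
file and no crux of the route is.

Part 1 (`…SigmaLineFamilyTransport`, p623105) is the identity of formal power series
`σ^{vc•V}_{c'} ∘ θ = u·σ^V_{u²c'−r}` (`θ = formalVariableChange V vc`). The σ-line height of the K-SEP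
texts reads VALUES `σ_c(z(P))`, `log(z(P))` at rational points of the admissible locus `‖x(P)‖_p > 1`
(where `‖z(P)‖ ≤ p⁻¹`, cycu-p1 `norm_param_le_inv_prime`), and `σ_c` converges only on Bernardi's CLOSED
disc `‖z‖ ≤ p⁻¹` — so the composition has to be evaluated by REARRANGEMENT, not by the integral
`padicEval_subst` of the tree (which is what `CountingDoorF2AtThreeSchneiderOnDoorSubfamilyTransportSigma`
uses for the INTEGRAL Mazur–Tate `σ_p` at a good ordinary prime). This file:

* §1 `norm_term_subst_le_of_weighted`, `summable_double_subst_of_weighted`,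
  **`padicEval_subst_of_weighted`** — a reusable evaluation theorem: for `f` with Bernardi-type weights
  `‖[tᵈ]f‖ ≤ A·√pᵈ`, `g ∈ ℤ_p⟦t⟧` with `g(0) = 0`, and `‖z‖ ≤ p⁻¹`: `Σ‖[f∘g]ₙzⁿ‖ < ∞` and
  `(f ∘ g)(z) = f(g(z))` (cycu-p1's rearrangement theorem `padicEval_subst_eq_tsum` with the majorant
  `A·G(d, 2m)` of `…BoundaryEvaluation`; the case `g = [n]`, `f = σ_c²` is cycu-p1's
  `padicEval_formalSigma_sq_subst_formalMul`).
* §2 `padicEval_formalSigma_smul_at`, `padicEval_formalLog_smul_at` — for a `p`-integral `V/ℚ_p`, a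
  `p`-integral change `vc` with `u ∈ ℤ_pˣ`, `‖c'‖ ≤ 1`, `p ≥ 3`, `‖z‖ ≤ p⁻¹`:
  **`σ^{vc•V}_{c'}(θ(z)) = u·σ^V_{u²c'−r}(z)`** and **`log^{vc•V}(θ(z)) = u·log^V(z)`**.
* §3 `padicEval_formalSigma_smul_point`, `padicEval_formalLog_smul_point` — at a point `P = (x, y)`,
  `‖x‖ > 1`, with image `P' = (x', y') = (u⁻²(x − r), u⁻³(y − s(x − r) − t))` on `vc • V`
  (`θ(z(P)) = z(P')`, CountingDoor's `padicEval_formalVariableChange_eq`):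
  **`σ^{vc•V}_{c'}(−x'/y') = u·σ^V_{u²c'−r}(−x/y)`**, **`log^{vc•V}(−x'/y') = u·log^V(−x/y)`**; squared
  log INVARIANT for `u² = 1` (`padicEval_formalLog_sq_smul_point_of_u_sq_eq_one`).

Part 3 (`…SigmaLineFamilyModelCovariance`) reads these at rational points of two globally minimal
models over `ℚ` (`u = ±1`, `r, s, t ∈ ℤ`) for the census `sigmaHeight` and the D5 datum.

References: Mazur–Tate 1991 §3, Thm. 3.1 [MazurTate1991]; Mazur–Stein–Tate 2006 Thm. 1.3, §1
[MazurSteinTate2006]; D. Bernardi, Sém. Théorie des Nombres Paris 1979–80 (Progr. Math. 12), §1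
[Bernardi1981]; A. Robert, *A Course in p-adic Analysis* (2000) Ch. V §4.2 [Robert2000PadicAnalysis];
Silverman AEC III.1, IV.1, VII.2.2 [SilvermanAEC2009].
-/

set_option autoImplicit false
-- single-conjunct summit: `Summit.BirchSwinnertonDyer.BirchSwinnertonDyer.…` repeats the name by design
set_option linter.dupNamespace false

noncomputable section

open scoped Classical

open PowerSeries WeierstrassCurve Literature.NumberTheory.EllipticCurves Literature.RingTheory.FormalGroups
  Summit.BirchSwinnertonDyer.BirchSwinnertonDyer.Theorems.PSSigmaLineFamily
  Summit.BirchSwinnertonDyer.BirchSwinnertonDyer.Theorems.PSSigmaLineFamilySharpRadius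
  Summit.BirchSwinnertonDyer.BirchSwinnertonDyer.Theorems.PSSigmaLineFamilyBoundaryEvaluation
  Summit.BirchSwinnertonDyer.BirchSwinnertonDyer.Theorems.PSSigmaLineFamilyDivision
  Summit.BirchSwinnertonDyer.BirchSwinnertonDyer.Theorems.PSSigmaLineFamilyConvergence
  Summit.BirchSwinnertonDyer.BirchSwinnertonDyer.Theorems.PSSigmaLineFamilyEvaluation
  Summit.BirchSwinnertonDyer.BirchSwinnertonDyer.Theorems.PSSigmaLineFamilyTransport

namespace Summit.BirchSwinnertonDyer.BirchSwinnertonDyer.Theorems.PSSigmaLineFamilyTransportEval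

/-! ### §1 Evaluation of `f ∘ g` on the closed disc for Bernardi-weighted `f` and integral `g` -/

section Weighted

variable {p : ℕ} [Fact p.Prime]

/-- The majorant of the double family `T(d,m) = f_d·[g^d]_m·z^m` for `‖f_d‖ ≤ A·√pᵈ`, `g` integral with
`g(0) = 0`, `‖z‖ ≤ p⁻¹`: `‖T(d,m)‖ ≤ A·G(d, 2m)` with `G(d,n) = [2d ≤ n]·√pᵈ·((√p)⁻¹)ⁿ` the summable majorant
of `…BoundaryEvaluation` (`[g^d]_m = 0` for `m < d`, `‖[g^d]_m‖ ≤ 1`, `‖z‖^m ≤ ((√p)⁻¹)^{2m}`).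
[Robert 2000, Ch. V §4.2] [folklore] -/
theorem norm_term_subst_le_of_weighted {f g : ℚ_[p]⟦X⟧} {A : ℝ} (hA : 0 ≤ A)
    (hf : ∀ d, ‖coeff d f‖ ≤ A * √(p : ℝ) ^ d) (hg : IsPadicInt g) (hg0 : constantCoeff g = 0)
    {z : ℚ_[p]} (hz : ‖z‖ ≤ (p : ℝ)⁻¹) (d m : ℕ) :
    ‖coeff d f * (coeff m (g ^ d) * z ^ m)‖ ≤
      A * (if 2 * d ≤ 2 * m then √(p : ℝ) ^ d * ((√(p : ℝ))⁻¹) ^ (2 * m) else 0) := by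
  obtain ⟨-, hρ, h2⟩ := one_le_sqrt_prime (p := p)
  split_ifs with hdm
  · rw [norm_mul, norm_mul, norm_pow]
    have hint : ‖coeff m (g ^ d)‖ ≤ 1 := isPadicInt_iff_coeff.mp (hg.pow d) m
    have hsq : ((√(p : ℝ))⁻¹) ^ (2 * m) = ((p : ℝ)⁻¹) ^ m := by rw [pow_mul, inv_pow, h2]
    rw [hsq]
    calc ‖coeff d f‖ * (‖coeff m (g ^ d)‖ * ‖z‖ ^ m)
        ≤ (A * √(p : ℝ) ^ d) * (1 * ((p : ℝ)⁻¹) ^ m) := by gcongr; exact hf d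
      _ = A * (√(p : ℝ) ^ d * ((p : ℝ)⁻¹) ^ m) := by ring
  · rw [coeff_pow_eq_zero_of_lt hg0 (show m < d by omega), zero_mul, mul_zero, norm_zero, mul_zero]

/-- **Absolute double summability** of `Σ_{d,m} f_d·[g^d]_m·z^m` for `‖f_d‖ ≤ A·√pᵈ`, `g ∈ ℤ_p⟦t⟧`,
`g(0) = 0`, `‖z‖ ≤ p⁻¹`. [Robert 2000, Ch. V §4.2] [cite: Robert2000PadicAnalysis, Ch. V §4.2 Proposition 3] -/
theorem summable_double_subst_of_weighted {f g : ℚ_[p]⟦X⟧} {A : ℝ} (hA : 0 ≤ A)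
    (hf : ∀ d, ‖coeff d f‖ ≤ A * √(p : ℝ) ^ d) (hg : IsPadicInt g) (hg0 : constantCoeff g = 0)
    {z : ℚ_[p]} (hz : ‖z‖ ≤ (p : ℝ)⁻¹) :
    Summable fun dm : ℕ × ℕ => ‖coeff dm.1 f * (coeff dm.2 (g ^ dm.1) * z ^ dm.2)‖ := by
  have hinj : Function.Injective fun dm : ℕ × ℕ => (dm.1, 2 * dm.2) := by
    rintro ⟨d, m⟩ ⟨d', m'⟩ h
    simp only [Prod.mk.injEq] at h
    exact Prod.ext h.1 (by omega)
  have hmaj := ((summable_majorant (p := p)).comp_injective hinj).mul_left A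
  exact Summable.of_nonneg_of_le (fun _ => norm_nonneg _)
    (fun dm => norm_term_subst_le_of_weighted hA hf hg hg0 hz dm.1 dm.2) hmaj

/-- **EVALUATION OF A COMPOSITION ON THE CLOSED DISC.** For `f ∈ ℚ_p⟦t⟧` with `‖[tᵈ]f‖ ≤ A·√pᵈ`
(Bernardi-type weights: `σ_c`, `log`, `σ_c²`, …), `g ∈ ℤ_p⟦t⟧` with `g(0) = 0`, and `‖z‖ ≤ p⁻¹`:
`Σ‖[f ∘ g]ₙ zⁿ‖ < ∞` and **`(f ∘ g)(z) = f(g(z))`** (`padicEval`). [Robert 2000, Ch. V §4.2]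
[cite: Robert2000PadicAnalysis, Ch. V §4.2 Proposition 3] -/
theorem padicEval_subst_of_weighted {f g : ℚ_[p]⟦X⟧} {A : ℝ} (hA : 0 ≤ A)
    (hf : ∀ d, ‖coeff d f‖ ≤ A * √(p : ℝ) ^ d) (hg : IsPadicInt g) (hg0 : constantCoeff g = 0)
    {z : ℚ_[p]} (hz : ‖z‖ ≤ (p : ℝ)⁻¹) :
    (Summable fun n : ℕ => ‖coeff n (f.subst g) * z ^ n‖) ∧
      padicEval (f.subst g) z = padicEval f (padicEval g z) := by
  have hgs := summable_norm_padicEval_of_isPadicInt hg (norm_lt_one_of_norm_le_inv_prime hz)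
  obtain ⟨hsum, heval⟩ := padicEval_subst_eq_tsum hg0 hgs
    (summable_double_subst_of_weighted hA hf hg hg0 hz)
  exact ⟨hsum, heval⟩

end Weighted

/-! ### §2 `σ^{vc•V}_{c'}(θ(z)) = u·σ^V_{u²c'−r}(z)` and `log^{vc•V}(θ(z)) = u·log^V(z)` on the disc -/

section Disc

variable {p : ℕ} [Fact p.Prime] (V : WeierstrassCurve ℚ_[p]) [V.IsIntegral ℤ_[p]]
  (vc : VariableChange ℚ_[p])

/-- The transported index stays integral: `‖u²c' − r‖ ≤ 1` for `‖u‖ = 1`, `‖c'‖ ≤ 1`, `‖r‖ ≤ 1`. [folklore] -/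
theorem norm_index_le_one (hu : ‖(vc.u : ℚ_[p])‖ = 1) (hr : ‖vc.r‖ ≤ 1) {c' : ℚ_[p]} (hc' : ‖c'‖ ≤ 1) :
    ‖(vc.u : ℚ_[p]) ^ 2 * c' - vc.r‖ ≤ 1 := by
  rw [sub_eq_add_neg]
  refine (IsUltrametricDist.norm_add_le_max _ _).trans (max_le ?_ (by rwa [norm_neg]))
  rw [norm_mul, norm_pow, hu, one_pow, one_mul]
  exact hc'

/-- **`(σ^{vc•V}_{c'} ∘ θ)(z) = σ^{vc•V}_{c'}(θ(z))` on `‖z‖ ≤ p⁻¹`** with absolute convergence of the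
composed series (`p ≥ 3`, `‖c'‖ ≤ 1`, `vc` integral with `u ∈ ℤ_pˣ`, so `vc • V` is `p`-integral and
Bernardi's weights apply to `σ^{vc•V}_{c'}`; `θ ∈ ℤ_p⟦z⟧`). [Bernardi 1981, §1; Robert 2000, Ch. V §4.2]
[cite: Robert2000PadicAnalysis, Ch. V §4.2 Proposition 3] -/
theorem padicEval_formalSigma_subst_formalVariableChange (hp : 3 ≤ p) (hu : ‖(vc.u : ℚ_[p])‖ = 1)
    (hr : ‖vc.r‖ ≤ 1) (hs : ‖vc.s‖ ≤ 1) (ht : ‖vc.t‖ ≤ 1) {c' : ℚ_[p]} (hc' : ‖c'‖ ≤ 1) {z : ℚ_[p]}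
    (hz : ‖z‖ ≤ (p : ℝ)⁻¹) :
    (Summable fun n : ℕ =>
        ‖coeff n (((vc • V).formalSigma c').subst (V.formalVariableChange vc)) * z ^ n‖) ∧
      padicEval (((vc • V).formalSigma c').subst (V.formalVariableChange vc)) z =
        padicEval ((vc • V).formalSigma c') (padicEval (V.formalVariableChange vc) z) := by
  obtain ⟨-, hρ, -⟩ := one_le_sqrt_prime (p := p)
  haveI := V.isIntegral_variableChange vc hu hr hs ht
  exact padicEval_subst_of_weighted (inv_nonneg.mpr hρ.le)
    (norm_coeff_formalSigma_le_weighted (vc • V) hp hc') (V.isPadicInt_formalVariableChange vc hu.le hr hs ht)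
    (V.constantCoeff_formalVariableChange vc) hz

/-- **`σ^{vc•V}_{c'}(θ(z)) = u·σ^V_{u²c'−r}(z)` on the closed disc `‖z‖ ≤ p⁻¹`** — the formal transport
`σ^{vc•V}_{c'} ∘ θ = u·σ^V_{u²c'−r}` (part 1) EVALUATED. [Mazur–Tate 1991, Thm. 3.1; Bernardi 1981, §1]
[cite: MazurTate1991, Thm. 3.1] [cite: Robert2000PadicAnalysis, Ch. V §4.2 Proposition 3] -/
theorem padicEval_formalSigma_smul_at (hp : 3 ≤ p) (hu : ‖(vc.u : ℚ_[p])‖ = 1) (hr : ‖vc.r‖ ≤ 1)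
    (hs : ‖vc.s‖ ≤ 1) (ht : ‖vc.t‖ ≤ 1) {c' : ℚ_[p]} (hc' : ‖c'‖ ≤ 1) {z : ℚ_[p]}
    (hz : ‖z‖ ≤ (p : ℝ)⁻¹) :
    padicEval ((vc • V).formalSigma c') (padicEval (V.formalVariableChange vc) z) =
      (vc.u : ℚ_[p]) * padicEval (V.formalSigma ((vc.u : ℚ_[p]) ^ 2 * c' - vc.r)) z := by
  rw [← (padicEval_formalSigma_subst_formalVariableChange V vc hp hu hr hs ht hc' hz).2,
    formalSigma_smul_subst, padicEval_C_mul']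

/-- **`(log^{vc•V} ∘ θ)(z) = log^{vc•V}(θ(z))` on `‖z‖ ≤ p⁻¹`** (`p ≥ 3`; `‖[tⁿ]log‖ ≤ (√p)⁻¹√pⁿ`,
cycu-p1 `norm_coeff_formalLog_le_weighted`). [Silverman AEC IV.6.4; Robert 2000, Ch. V §4.2]
[cite: Robert2000PadicAnalysis, Ch. V §4.2 Proposition 3] -/
theorem padicEval_formalLog_subst_formalVariableChange (hp : 3 ≤ p) (hu : ‖(vc.u : ℚ_[p])‖ = 1)
    (hr : ‖vc.r‖ ≤ 1) (hs : ‖vc.s‖ ≤ 1) (ht : ‖vc.t‖ ≤ 1) {z : ℚ_[p]} (hz : ‖z‖ ≤ (p : ℝ)⁻¹) :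
    (Summable fun n : ℕ =>
        ‖coeff n ((vc • V).formalLog.subst (V.formalVariableChange vc)) * z ^ n‖) ∧
      padicEval ((vc • V).formalLog.subst (V.formalVariableChange vc)) z =
        padicEval (vc • V).formalLog (padicEval (V.formalVariableChange vc) z) := by
  obtain ⟨-, hρ, -⟩ := one_le_sqrt_prime (p := p)
  haveI := V.isIntegral_variableChange vc hu hr hs ht
  exact padicEval_subst_of_weighted (inv_nonneg.mpr hρ.le)
    (norm_coeff_formalLog_le_weighted (vc • V) hp) (V.isPadicInt_formalVariableChange vc hu.le hr hs ht)
    (V.constantCoeff_formalVariableChange vc) hz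

/-- **`log^{vc•V}(θ(z)) = u·log^V(z)` on the closed disc `‖z‖ ≤ p⁻¹`** — the tree's `log' ∘ θ = u·log`
(`formalLog_variableChange_subst`) EVALUATED. [Silverman AEC IV.5, III.1] [cite: SilvermanAEC2009, IV.6.4]
[cite: Robert2000PadicAnalysis, Ch. V §4.2 Proposition 3] -/
theorem padicEval_formalLog_smul_at (hp : 3 ≤ p) (hu : ‖(vc.u : ℚ_[p])‖ = 1) (hr : ‖vc.r‖ ≤ 1)
    (hs : ‖vc.s‖ ≤ 1) (ht : ‖vc.t‖ ≤ 1) {z : ℚ_[p]} (hz : ‖z‖ ≤ (p : ℝ)⁻¹) :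
    padicEval (vc • V).formalLog (padicEval (V.formalVariableChange vc) z) =
      (vc.u : ℚ_[p]) * padicEval V.formalLog z := by
  rw [← (padicEval_formalLog_subst_formalVariableChange V vc hp hu hr hs ht hz).2,
    V.formalLog_variableChange_subst vc, padicEval_C_mul']

end Disc

/-! ### §3 At points of the kernel of reduction: `θ(z(P)) = z(P')` -/

section Point

variable {p : ℕ} [Fact p.Prime] (V : WeierstrassCurve ℚ_[p]) [V.IsIntegral ℤ_[p]]
  (vc : VariableChange ℚ_[p])

/-- **`σ^{vc•V}_{c'}(z(P')) = u·σ^V_{u²c'−r}(z(P))`** for `P = (x, y) ∈ V(ℚ_p)` with `‖x‖ > 1` and its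
image `P' = (x', y') = (u⁻²(x − r), u⁻³(y − s(x − r) − t))` on `vc • V` (`p ≥ 3`, `‖c'‖ ≤ 1`, `vc`
integral, `u ∈ ℤ_pˣ`): the VALUES of the two sigma families at corresponding points differ by the unit
`u` once the indices are matched by `c = u²c' − r`. [Mazur–Tate 1991, Thm. 3.1; Bernardi 1981, §1]
[cite: MazurTate1991, Thm. 3.1] [cite: SilvermanAEC2009, VII.2.2] -/
theorem padicEval_formalSigma_smul_point (hp : 3 ≤ p) (hu : ‖(vc.u : ℚ_[p])‖ = 1) (hr : ‖vc.r‖ ≤ 1)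
    (hs : ‖vc.s‖ ≤ 1) (ht : ‖vc.t‖ ≤ 1) {c' : ℚ_[p]} (hc' : ‖c'‖ ≤ 1) {x y : ℚ_[p]}
    (heq : V.toAffine.Equation x y) (hx : 1 < ‖x‖) :
    padicEval ((vc • V).formalSigma c') (-(vc.toX x) / vc.toY x y) =
      (vc.u : ℚ_[p]) * padicEval (V.formalSigma ((vc.u : ℚ_[p]) ^ 2 * c' - vc.r)) (-x / y) := by
  rw [← padicEval_formalVariableChange_eq V vc hu.le hr hs ht heq hx,
    padicEval_formalSigma_smul_at V vc hp hu hr hs ht hc'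
      (PSSigmaLineFamilyAdmissible.norm_param_le_inv_prime V heq hx)]

/-- The same with the index read from `V`: **`σ^V_c(z(P)) = u⁻¹·σ^{vc•V}_{(c+r)/u²}(z(P'))`**.
[cite: MazurTate1991, Thm. 3.1] [cite: SilvermanAEC2009, VII.2.2] -/
theorem padicEval_formalSigma_point_eq (hp : 3 ≤ p) (hu : ‖(vc.u : ℚ_[p])‖ = 1) (hr : ‖vc.r‖ ≤ 1)
    (hs : ‖vc.s‖ ≤ 1) (ht : ‖vc.t‖ ≤ 1) {c : ℚ_[p]} (hc : ‖c‖ ≤ 1) {x y : ℚ_[p]}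
    (heq : V.toAffine.Equation x y) (hx : 1 < ‖x‖) :
    padicEval (V.formalSigma c) (-x / y) =
      ((vc.u⁻¹ : ℚ_[p]ˣ) : ℚ_[p]) *
        padicEval ((vc • V).formalSigma (((vc.u⁻¹ : ℚ_[p]ˣ) : ℚ_[p]) ^ 2 * (c + vc.r)))
          (-(vc.toX x) / vc.toY x y) := by
  have hui : ‖((vc.u⁻¹ : ℚ_[p]ˣ) : ℚ_[p])‖ = 1 := by
    rw [Units.val_inv_eq_inv_val, norm_inv, hu, inv_one]
  have hc' : ‖((vc.u⁻¹ : ℚ_[p]ˣ) : ℚ_[p]) ^ 2 * (c + vc.r)‖ ≤ 1 := by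
    rw [norm_mul, norm_pow, hui, one_pow, one_mul]
    exact (IsUltrametricDist.norm_add_le_max _ _).trans (max_le hc hr)
  rw [padicEval_formalSigma_smul_point V vc hp hu hr hs ht hc' heq hx, u_sq_mul_inv_u_sq_mul_add_sub,
    ← mul_assoc, Units.inv_mul, one_mul]

/-- **`log^{vc•V}(z(P')) = u·log^V(z(P))`** at a point of the kernel of reduction (`p ≥ 3`).
[Silverman AEC IV.5, III.1] [cite: SilvermanAEC2009, IV.6.4] [cite: SilvermanAEC2009, VII.2.2] -/
theorem padicEval_formalLog_smul_point (hp : 3 ≤ p) (hu : ‖(vc.u : ℚ_[p])‖ = 1) (hr : ‖vc.r‖ ≤ 1)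
    (hs : ‖vc.s‖ ≤ 1) (ht : ‖vc.t‖ ≤ 1) {x y : ℚ_[p]} (heq : V.toAffine.Equation x y) (hx : 1 < ‖x‖) :
    padicEval (vc • V).formalLog (-(vc.toX x) / vc.toY x y) =
      (vc.u : ℚ_[p]) * padicEval V.formalLog (-x / y) := by
  rw [← padicEval_formalVariableChange_eq V vc hu.le hr hs ht heq hx,
    padicEval_formalLog_smul_at V vc hp hu hr hs ht
      (PSSigmaLineFamilyAdmissible.norm_param_le_inv_prime V heq hx)]

/-- For `u² = 1` (two globally minimal models): **`log^{vc•V}(z(P'))² = log^V(z(P))²`** — the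
`log²`-correction of the σ-line height is INVARIANT. [cite: SilvermanAEC2009, IV.6.4] -/
theorem padicEval_formalLog_sq_smul_point_of_u_sq_eq_one (hp : 3 ≤ p) (hu : ‖(vc.u : ℚ_[p])‖ = 1)
    (hu2 : (vc.u : ℚ_[p]) ^ 2 = 1) (hr : ‖vc.r‖ ≤ 1) (hs : ‖vc.s‖ ≤ 1) (ht : ‖vc.t‖ ≤ 1) {x y : ℚ_[p]}
    (heq : V.toAffine.Equation x y) (hx : 1 < ‖x‖) :
    padicEval (vc • V).formalLog (-(vc.toX x) / vc.toY x y) ^ 2 = padicEval V.formalLog (-x / y) ^ 2 := by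
  rw [padicEval_formalLog_smul_point V vc hp hu hr hs ht heq hx, mul_pow, hu2, one_mul]

/-- For `u² = 1`: **`σ^{vc•V}_{c'}(z(P')) = u·σ^V_{c'−r}(z(P))`** — «c shifts by r», the value by the sign
`u = ±1`. [cite: MazurTate1991, Thm. 3.1] [cite: SilvermanAEC2009, VII.1.3(b) and VIII.8.3] -/
theorem padicEval_formalSigma_smul_point_of_u_sq_eq_one (hp : 3 ≤ p) (hu : ‖(vc.u : ℚ_[p])‖ = 1)
    (hu2 : (vc.u : ℚ_[p]) ^ 2 = 1) (hr : ‖vc.r‖ ≤ 1) (hs : ‖vc.s‖ ≤ 1) (ht : ‖vc.t‖ ≤ 1) {c' : ℚ_[p]}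
    (hc' : ‖c'‖ ≤ 1) {x y : ℚ_[p]} (heq : V.toAffine.Equation x y) (hx : 1 < ‖x‖) :
    padicEval ((vc • V).formalSigma c') (-(vc.toX x) / vc.toY x y) =
      (vc.u : ℚ_[p]) * padicEval (V.formalSigma (c' - vc.r)) (-x / y) := by
  rw [padicEval_formalSigma_smul_point V vc hp hu hr hs ht hc' heq hx, hu2, one_mul]

end Point

end Summit.BirchSwinnertonDyer.BirchSwinnertonDyer.Theorems.PSSigmaLineFamilyTransportEval

end
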